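import Literature.Analysis.FluidPDE.KochTataru
import Mathlib.MeasureTheory.Integral.IntegralEqImproper
import HarnessLib

/-!
# Parabolic scaling of the Oseen–Koch–Tataru kernel: `K(λ²τ, λz) = λ^{-(d+1)} K(τ, z)`

Analysis/FluidPDE support file (everything proved). The kernel `K(τ, z)[a, b] = oseenKernel τ z a b`
of `e^{τΔ} P ∇·` (`KochTataru.lean`; Koch–Tataru 2001, §2 (8)) is homogeneous under the
parabolic dilations `(τ, z) ↦ (λ²τ, λz)`: it is built from the Gauss–Weierstrass kernel
(`G_{λ²τ}(λz) = λ^{-d} G_τ(z)`, `heatKernel_sq_mul_smul_of_nonneg`) and the half-line Gaussian moments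
`A(τ, z) = ∫_τ^∞ G_s(z)/(4s²) ds`, `B(τ, z) = ∫_τ^∞ G_s(z)/(8s³) ds`
(`A(λ²τ, λz) = λ^{-d-2} A(τ, z)`, `B(λ²τ, λz) = λ^{-d-4} B(τ, z)`: the substitution `s = λ²r`,
`oseenWeightA_sq_mul_smul`, `oseenWeightB_sq_mul_smul`), whence
`K(λ²τ, λz)[a, b] = λ^{-(d+1)} K(τ, z)[a, b]` for `λ > 0`, `τ > 0` (`oseenKernel_sq_mul_smul`).
This is the scaling behind Koch–Tataru's bound (14), `|K(x,t)| ≤ c(√t + |x|)^{-d-1}`, and behind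
the weights `t^{k/2}` of Koch–Nadirashvili–Seregin–Šverák 2009, Prop. 4.1 (the Navier–Stokes
scaling `u(x,t) ↦ λu(λx, λ²t)`, §1 (1.3)): it turns derivative bounds for `K(1, ·)` into the sharp
bounds `‖D^m_{(τ,z)} K(τ, ·)‖_{L¹} ≲ τ^{-1/2-m}` at small times.

## References

* H. Koch, D. Tataru, *Well-posedness for the Navier–Stokes equations*, Adv. Math. 157 (2001),
  §2 (6)–(8), §3 (14). [KochTataruAdvMath2001]
* G. Koch, N. Nadirashvili, G. Seregin, V. Šverák, Acta Math. 203 (2009), §1 (1.3) (scaling),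
  Prop. 4.1. [KochNadirashviliSereginSverak2009]
-/

noncomputable section

open MeasureTheory Set Real
open scoped RealInnerProductSpace

namespace Literature.Analysis.FluidPDE

variable {E : Type*} [NormedAddCommGroup E] [InnerProductSpace ℝ E]

/-- **Scaling of the heat kernel**: `G_{λ²τ}(λ z) = λ^{-d} G_τ(z)` for `λ > 0`, `τ ≥ 0` (the twin
of `heatKernel_sq_mul_smul` of `SelfSimilarProofs.lean`, which assumes `τ > 0`)
(Evans, §2.3.1). [folklore] -/
theorem heatKernel_sq_mul_smul_of_nonneg {lam : ℝ} (hl : 0 < lam) {τ : ℝ} (hτ : 0 ≤ τ) (z : E) :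
    UnboundedOperators.heatKernel (lam ^ 2 * τ) (lam • z) =
      (lam ^ Module.finrank ℝ E)⁻¹ * UnboundedOperators.heatKernel τ z := by
  set d : ℕ := Module.finrank ℝ E with hd
  rw [UnboundedOperators.heatKernel_eq, UnboundedOperators.heatKernel_eq]
  have hl2 : 0 < lam ^ 2 := by positivity
  have hexp : -(1 / (4 * (lam ^ 2 * τ))) * ‖lam • z‖ ^ 2 = -(1 / (4 * τ)) * ‖z‖ ^ 2 := by
    rw [norm_smul, Real.norm_of_nonneg hl.le, mul_pow]
    rcases eq_or_lt_of_le hτ with h | h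
    · subst h; simp
    · field_simp
  rw [hexp]
  have hpow : (4 * π * (lam ^ 2 * τ)) ^ (-(d : ℝ) / 2) = (lam ^ d)⁻¹ * (4 * π * τ) ^ (-(d : ℝ) / 2) := by
    rw [show 4 * π * (lam ^ 2 * τ) = lam ^ 2 * (4 * π * τ) by ring,
      Real.mul_rpow hl2.le (by positivity)]
    congr 1
    rw [show (lam ^ 2 : ℝ) = lam ^ (2 : ℝ) by norm_cast, ← Real.rpow_mul hl.le,
      show (2 : ℝ) * (-(d : ℝ) / 2) = -(d : ℝ) by ring, Real.rpow_neg hl.le, Real.rpow_natCast]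
  rw [hpow]
  ring

/-- **Scaling of the first Gaussian weight**: `A(λ²τ, λz) = λ^{-d-2} A(τ, z)` for `λ > 0`,
`τ ≥ 0` (the substitution `s = λ² r` in `∫_τ^∞ G_s(z)/(4s²) ds`). [cite: KochTataruAdvMath2001, §2 (6)–(8)] -/
theorem oseenWeightA_sq_mul_smul {lam : ℝ} (hl : 0 < lam) {τ : ℝ} (hτ : 0 ≤ τ) (z : E) :
    oseenWeightA (lam ^ 2 * τ) (lam • z) = (lam ^ (Module.finrank ℝ E + 2))⁻¹ * oseenWeightA τ z := by
  set d : ℕ := Module.finrank ℝ E with hd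
  have hl2 : 0 < lam ^ 2 := by positivity
  simp only [oseenWeightA]
  have hsub := integral_comp_mul_left_Ioi
    (fun s => UnboundedOperators.heatKernel s (lam • z) / (4 * s ^ 2)) τ hl2
  -- the integrand after substitution
  have heq : ∀ r ∈ Ioi τ, UnboundedOperators.heatKernel (lam ^ 2 * r) (lam • z) / (4 * (lam ^ 2 * r) ^ 2) =
      (lam ^ (d + 4))⁻¹ * (UnboundedOperators.heatKernel r z / (4 * r ^ 2)) := by
    intro r hr
    have hr0 : 0 ≤ r := hτ.trans (le_of_lt hr)
    rw [heatKernel_sq_mul_smul_of_nonneg hl hr0 z]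
    have hl0 : lam ≠ 0 := hl.ne'
    field_simp
    ring
  rw [setIntegral_congr_fun measurableSet_Ioi heq, integral_const_mul, smul_eq_mul] at hsub
  -- solve for the substituted integral
  have hl4 : (lam ^ (d + 4))⁻¹ = (lam ^ 2)⁻¹ * (lam ^ (d + 2))⁻¹ := by
    rw [← mul_inv, ← pow_add, show 2 + (d + 2) = d + 4 by omega]
  rw [hl4, mul_assoc] at hsub
  have := mul_left_cancel₀ (inv_ne_zero hl2.ne') hsub
  exact this.symm

/-- **Scaling of the second Gaussian weight**: `B(λ²τ, λz) = λ^{-d-4} B(τ, z)` for `λ > 0`,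
`τ ≥ 0`. [cite: KochTataruAdvMath2001, §2 (6)–(8)] -/
theorem oseenWeightB_sq_mul_smul {lam : ℝ} (hl : 0 < lam) {τ : ℝ} (hτ : 0 ≤ τ) (z : E) :
    oseenWeightB (lam ^ 2 * τ) (lam • z) = (lam ^ (Module.finrank ℝ E + 4))⁻¹ * oseenWeightB τ z := by
  set d : ℕ := Module.finrank ℝ E with hd
  have hl2 : 0 < lam ^ 2 := by positivity
  simp only [oseenWeightB]
  have hsub := integral_comp_mul_left_Ioi
    (fun s => UnboundedOperators.heatKernel s (lam • z) / (8 * s ^ 3)) τ hl2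
  have heq : ∀ r ∈ Ioi τ, UnboundedOperators.heatKernel (lam ^ 2 * r) (lam • z) / (8 * (lam ^ 2 * r) ^ 3) =
      (lam ^ (d + 6))⁻¹ * (UnboundedOperators.heatKernel r z / (8 * r ^ 3)) := by
    intro r hr
    have hr0 : 0 ≤ r := hτ.trans (le_of_lt hr)
    rw [heatKernel_sq_mul_smul_of_nonneg hl hr0 z]
    have hl0 : lam ≠ 0 := hl.ne'
    field_simp
    ring
  rw [setIntegral_congr_fun measurableSet_Ioi heq, integral_const_mul, smul_eq_mul] at hsub
  have hl6 : (lam ^ (d + 6))⁻¹ = (lam ^ 2)⁻¹ * (lam ^ (d + 4))⁻¹ := by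
    rw [← mul_inv, ← pow_add, show 2 + (d + 4) = d + 6 by omega]
  rw [hl6, mul_assoc] at hsub
  have := mul_left_cancel₀ (inv_ne_zero hl2.ne') hsub
  exact this.symm

/-- **Parabolic scaling of the Oseen–Koch–Tataru kernel**: for `λ > 0`, `τ > 0`,
`K(λ²τ, λz)[a, b] = λ^{-(d+1)} K(τ, z)[a, b]` (Koch–Tataru 2001, (8) and (14); the source of the
weights `t^{k/2}` in KNSS 2009, Prop. 4.1). [cite: KochTataruAdvMath2001, §2 (8) and §3 (14)] -/
theorem oseenKernel_sq_mul_smul {lam : ℝ} (hl : 0 < lam) {τ : ℝ} (hτ : 0 < τ) (z a b : E) :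
    oseenKernel (lam ^ 2 * τ) (lam • z) a b = (lam ^ (Module.finrank ℝ E + 1))⁻¹ • oseenKernel τ z a b := by
  set d : ℕ := Module.finrank ℝ E with hd
  have hl0 : lam ≠ 0 := hl.ne'
  simp only [oseenKernel]
  rw [heatKernel_sq_mul_smul_of_nonneg hl hτ.le z, oseenWeightA_sq_mul_smul hl hτ.le z,
    oseenWeightB_sq_mul_smul hl hτ.le z]
  simp only [inner_smul_left, conj_trivial, smul_add, smul_sub, smul_smul]
  have hpow2 : lam ^ (d + 2) = lam ^ (d + 1) * lam := by rw [pow_succ]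
  have hpow4 : lam ^ (d + 4) = lam ^ (d + 1) * lam ^ 3 := by rw [← pow_add]
  have hpowd : lam ^ (d + 1) = lam ^ d * lam := by rw [pow_succ]
  match_scalars <;> field_simp <;> ring

end Literature.Analysis.FluidPDE

end
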